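import Summits.Parity.GeneralizedHardyLittlewood.Theorems.BeyondDiagonalBeatsQuarter.OffDiagLevelLargeSieve
import HarnessLib

/-!
# Route `PrimeLevelFamEdge`, crux K_B (stmt-Parity-20343), line `diagonal_kernel_split` rev 4, plan Ω,
# node **L7d part 2, leaf F2a — the level large sieve for an indexed family in the AGGREGATE (ℓ¹-fibre) form**
# (L7D-PLAN rev 6 §6 F2; companion of prover-7's `OffDiagLevelLargeSieve`)

prover-7's index form `norm_sum_mul_levelLargePart_le_of_multiplicity(_zmod)` weighs each member by a multiplicity
`m(h) ≥ #{members in one class of modulus h}`. For the D5b family the members of one class spread over all Petersson layers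
`r < (2N)⁷` with weights `∝ (r+1)⁻¹`: a COUNT is useless there, an ℓ¹-aggregate is not. This file records the aggregate form
(same proof: regroup by (modulus, class), weighted Cauchy–Schwarz `norm_sum_moduli_sum_coprime_mul_levelLargePart_le`,
then `‖Σ_{fibre} w‖ ≤ Σ_{fibre} ‖w‖`):

* **`norm_sum_mul_levelLargePart_le_aggregate`** — `‖Σ_{i∈I} w_i·levelLargePart R Q F (md i) (cl i)‖ ≤
  (Σ_{h≤H} Σ_{c<h,(c,h)=1} (Σ_{i∈I: md i = h, cl i = c} ‖w_i‖)²)^{1/2}·(1 + log H)(2(N+1)/R + 4H)^{1/2}‖F‖₂`;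
* `…_aggregate_zmod` — classes as units of `ZMod (md i)` (fibres on `.val`);
* `…_aggregate_of_subset_primes` — `Q ⊆` primes of `(N₀, 2N₀]`, `H ≤ N₀`.

Pure inequalities for finite sums; standard axioms. Helper toward `stub_offDiagBelowSlack_io`; closes nothing.
«The programme SEARCHES and TYPES; no claim about Landau–Siegel zeros, Theorems 1–2 of arXiv:2211.02515 or
a repaired Margin232 until a kernel theorem says so.»
-/

noncomputable section

namespace Summit.Parity.GeneralizedHardyLittlewood.Theorems.BeyondDiagonalBeatsQuarter.OffDiag

open Finset

section AllModuli

variable (Q : Finset ℕ) (F : ℕ → ℂ) {M₀ N R H : ℕ}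

/-- **Aggregate (ℓ¹-fibre) index form of the large-sieve bound.** A finite family `i ∈ I` of (modulus, class-representative)
pairs `(md i, cl i)` with `1 ≤ md i ≤ H`, `cl i < md i`, `(cl i, md i) = 1` and weights `w i`:
`‖Σ_{i∈I} w_i·levelLargePart R Q F (md i) (cl i)‖ ≤ (Σ_{h,c} (Σ_{i: (md i, cl i) = (h,c)} ‖w_i‖)²)^{1/2}·(1 + log H)(2(N+1)/R + 4H)^{1/2}‖F‖₂`
(`Q ⊆ (M₀, M₀+N]` coprime to all moduli `≤ H`, `1 ≤ R`). [cite: Davenport1980, ch. 29 — derivation; IwaniecKowalski2004, §17.3 — derivation] -/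
theorem norm_sum_mul_levelLargePart_le_aggregate (hR : 1 ≤ R) (hQ : Q ⊆ Finset.Ioc M₀ (M₀ + N))
    (hcop : ∀ q ∈ Q, ∀ h ∈ Finset.Icc 1 H, Nat.Coprime q h) {ι : Type*} (I : Finset ι) (md cl : ι → ℕ)
    (w : ι → ℂ) (hI : ∀ i ∈ I, md i ∈ Finset.Icc 1 H ∧ cl i < md i ∧ (cl i).Coprime (md i)) :
    ‖∑ i ∈ I, w i * levelLargePart R Q F (md i) (cl i : ZMod (md i))‖ ≤
      Real.sqrt (∑ h ∈ Finset.Icc 1 H, ∑ c ∈ (Finset.range h).filter (fun c ↦ c.Coprime h),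
          (∑ i ∈ I.filter (fun i ↦ md i = h ∧ cl i = c), ‖w i‖) ^ 2) *
        ((1 + Real.log H) * Real.sqrt (2 * ((N : ℝ) + 1) / R + 4 * H) * Real.sqrt (∑ q ∈ Q, ‖F q‖ ^ 2)) := by
  classical
  set t : Finset (Σ _ : ℕ, ℕ) :=
    (Finset.Icc 1 H).sigma (fun h ↦ (Finset.range h).filter (fun c ↦ c.Coprime h)) with ht
  set key : ι → (Σ _ : ℕ, ℕ) := fun i ↦ ⟨md i, cl i⟩ with hkeydef
  have hkey : ∀ i ∈ I, key i ∈ t := by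
    intro i hi
    obtain ⟨h1, h2, h3⟩ := hI i hi
    rw [ht, Finset.mem_sigma]
    exact ⟨h1, Finset.mem_filter.2 ⟨Finset.mem_range.2 h2, h3⟩⟩
  -- grouped weights
  set W : ℕ → ℕ → ℂ := fun h c ↦ ∑ i ∈ I.filter (fun i ↦ key i = ⟨h, c⟩), w i with hW
  have hregroup : ∑ i ∈ I, w i * levelLargePart R Q F (md i) (cl i : ZMod (md i)) =
      ∑ h ∈ Finset.Icc 1 H, ∑ c ∈ (Finset.range h).filter (fun c ↦ c.Coprime h),
        W h c * levelLargePart R Q F h (c : ZMod h) := by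
    rw [← Finset.sum_fiberwise_of_maps_to hkey (fun i ↦ w i * levelLargePart R Q F (md i) (cl i : ZMod (md i))),
      ht, Finset.sum_sigma]
    refine Finset.sum_congr rfl fun h _ ↦ Finset.sum_congr rfl fun c _ ↦ ?_
    rw [hW, Finset.sum_mul]
    refine Finset.sum_congr rfl fun i hi ↦ ?_
    have hk : key i = ⟨h, c⟩ := (Finset.mem_filter.1 hi).2
    simp only [hkeydef, Sigma.mk.injEq] at hk
    obtain ⟨rfl, hk2⟩ := hk
    rw [eq_of_heq hk2]
  -- the grouped ℓ²-norm against the ℓ¹-fibres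
  have hfib : ∀ h c, I.filter (fun i ↦ key i = ⟨h, c⟩) = I.filter (fun i ↦ md i = h ∧ cl i = c) := by
    intro h c
    refine Finset.filter_congr fun i _ ↦ ?_
    simp only [hkeydef, Sigma.mk.injEq, heq_eq_eq]
  have hW2 : ∑ h ∈ Finset.Icc 1 H, ∑ c ∈ (Finset.range h).filter (fun c ↦ c.Coprime h), ‖W h c‖ ^ 2 ≤
      ∑ h ∈ Finset.Icc 1 H, ∑ c ∈ (Finset.range h).filter (fun c ↦ c.Coprime h),
        (∑ i ∈ I.filter (fun i ↦ md i = h ∧ cl i = c), ‖w i‖) ^ 2 := by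
    refine Finset.sum_le_sum fun h _ ↦ Finset.sum_le_sum fun c _ ↦ ?_
    rw [hW]
    dsimp only
    rw [hfib h c]
    gcongr
    exact norm_sum_le _ _
  rw [hregroup]
  refine (norm_sum_moduli_sum_coprime_mul_levelLargePart_le Q F hR hQ hcop W).trans ?_
  exact mul_le_mul_of_nonneg_right (Real.sqrt_le_sqrt hW2) (by positivity)

/-- **Aggregate form with classes given as units of `ZMod (md i)`** (fibres counted on the representatives `(a i).val`).
[cite: Davenport1980, ch. 29 — derivation; IwaniecKowalski2004, §17.3 — derivation] -/
theorem norm_sum_mul_levelLargePart_le_aggregate_zmod (hR : 1 ≤ R) (hQ : Q ⊆ Finset.Ioc M₀ (M₀ + N))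
    (hcop : ∀ q ∈ Q, ∀ h ∈ Finset.Icc 1 H, Nat.Coprime q h) {ι : Type*} (I : Finset ι) (md : ι → ℕ)
    (a : (i : ι) → ZMod (md i)) (w : ι → ℂ) (hI : ∀ i ∈ I, md i ∈ Finset.Icc 1 H ∧ IsUnit (a i)) :
    ‖∑ i ∈ I, w i * levelLargePart R Q F (md i) (a i)‖ ≤
      Real.sqrt (∑ h ∈ Finset.Icc 1 H, ∑ c ∈ (Finset.range h).filter (fun c ↦ c.Coprime h),
          (∑ i ∈ I.filter (fun i ↦ md i = h ∧ (a i).val = c), ‖w i‖) ^ 2) *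
        ((1 + Real.log H) * Real.sqrt (2 * ((N : ℝ) + 1) / R + 4 * H) * Real.sqrt (∑ q ∈ Q, ‖F q‖ ^ 2)) := by
  have hval : ∀ i ∈ I, ((a i).val : ZMod (md i)) = a i := by
    intro i hi
    haveI : NeZero (md i) := ⟨by have := (Finset.mem_Icc.1 (hI i hi).1).1; omega⟩
    exact ZMod.natCast_zmod_val (a i)
  rw [Finset.sum_congr rfl fun i hi ↦ by rw [← hval i hi]]
  refine norm_sum_mul_levelLargePart_le_aggregate Q F hR hQ hcop I md (fun i ↦ (a i).val) w
    (fun i hi ↦ ⟨(hI i hi).1, ?_, ?_⟩)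
  · haveI : NeZero (md i) := ⟨by have := (Finset.mem_Icc.1 (hI i hi).1).1; omega⟩
    exact ZMod.val_lt _
  · obtain ⟨u, hu⟩ := (hI i hi).2
    rw [← hu]
    exact ZMod.val_coe_unit_coprime u

/-- **Prime-level specialisation**: `Q ⊆` primes of `(N₀, 2N₀]`, moduli `≤ H ≤ N₀` (coprimality automatic).
[cite: Davenport1980, ch. 29 — derivation; IwaniecKowalski2004, §17.3 — derivation] -/
theorem norm_sum_mul_levelLargePart_le_aggregate_zmod_of_subset_primes {N₀ : ℕ} (hR : 1 ≤ R)
    (hQ : Q ⊆ (Finset.Ioc N₀ (2 * N₀)).filter Nat.Prime) (hH : H ≤ N₀) {ι : Type*} (I : Finset ι)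
    (md : ι → ℕ) (a : (i : ι) → ZMod (md i)) (w : ι → ℂ) (hI : ∀ i ∈ I, md i ∈ Finset.Icc 1 H ∧ IsUnit (a i)) :
    ‖∑ i ∈ I, w i * levelLargePart R Q F (md i) (a i)‖ ≤
      Real.sqrt (∑ h ∈ Finset.Icc 1 H, ∑ c ∈ (Finset.range h).filter (fun c ↦ c.Coprime h),
          (∑ i ∈ I.filter (fun i ↦ md i = h ∧ (a i).val = c), ‖w i‖) ^ 2) *
        ((1 + Real.log H) * Real.sqrt (2 * ((N₀ : ℝ) + 1) / R + 4 * H) * Real.sqrt (∑ q ∈ Q, ‖F q‖ ^ 2)) :=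
  norm_sum_mul_levelLargePart_le_aggregate_zmod Q F hR (coprime_moduli_of_subset_primes Q hQ hH).1
    (coprime_moduli_of_subset_primes Q hQ hH).2 I md a w hI

end AllModuli

end Summit.Parity.GeneralizedHardyLittlewood.Theorems.BeyondDiagonalBeatsQuarter.OffDiag
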